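/-
Copyright: the b2b-balaban cell (near-miss cell 7), T⁴-continuum fan-out; row NE7b ROUND-2 swarm, seat
t4-ne7b-formalise-leaf-05 gen 3 (row S6g′ INSTANCE of `t4/b2b-balaban-t4-ne7b-p1/LEAVES-NE7b.md`, owner's ruling
R-OWNER-22-20 (2); leaf-10 gen 3's request journal l.≈11418).  Released under the licence of the surrounding project.
-/
import Summits.QuantumFields.BalabanUV.T4Continuum.Support.HistoryRenewalsCostFlat
import Summits.QuantumFields.BalabanUV.T4Continuum.Support.HistorySiblingEntropyListing

/-!
# The sibling-entropy input of the binding on a CANONICALLY WRITTEN pedigree, renewals paid by the booked cost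
# (row S6g′, «INST-NR» part 3 = part 2 ∘ leaf-10 gen 3's `ENT_leR_gen`)

Summits-side support leaf of the T⁴-continuum cell (rung (B)+1 on a FINITE torus only; NOT infinite volume, NOT the
mass gap, NOT the Clay statement; NOT a proof of the spine estimate NE7b).  Row NE7b, route «COUNT», row S6g′; a
three-line composition, [folklore]; nothing is quoted from print, nothing printed is asserted, no `[cite:]` tag, no
`Prop` fact minted, no definition.

WHAT.  Leaf-10 gen 3's `HistorySiblingEntropyBridge.ENT_leR_gen` discharges the order ∕ label display `InjPartsR` on the
FLAT genealogy `P.gen c` of a pedigree written with the three conventions `HeadOldest`, `TailSortedR`, `RenewDated`,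
leaving `8·NR PEv.step (P.gen c)`; part 2's `NR_relabel_le_totalCostT_div` pays that count by the TAGGED member's booked
cost.  END **`ENT_le_gen_canon`**:
`(∀ c, P.HeadOldest c) → (∀ c, P.TailSortedR c) → P.RenewDated → (∀ c, P.Forest c) →
 ConsistentTLE Prod.fst C K R (P.genT c) → (∀ n ≤ K, φ ≤ floorK C K R n), 0 < φ →
 ENT PEv.step (P.gen c) ≤ 2·bsum (1 + PEv.fat) (P.gen c) + 4·partnerAges PEv.step (P.gen c) + 8·mrg PEv.step (P.gen c)
   + (8 ∕ φ)·totalCostT Prod.fst C K R (P.genT c)`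
— the binder `hENT` of `HistoryJoinsEnd.card_S_le_exp_pow` on the tree it counts on, with constants
`(κ_bsum, κ_pA, κ_mrg, κ_T) = (2, 4, 8, 8∕φ)` and NO genericity ∕ `ShapeSorted` ∕ `InjParts*` display; reading
`ENT_le_gen_canon_E₂` (`φ = E₂`, `R ≥ 1` on the run).

HONEST SCOPE.  Displayed, with named suppliers: the writing conventions (reading map, row S1c — `TailSortedR` is
realisable only once the join clause is order-free, S1c file 1), `Forest` (S3), the tagged member's `ConsistentTLE`
(H1b: `HistoryRealiseTimed.consistentTLE_genT_of_realises`), floors `≥ φ` on the run (the flow).  The constant check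
`exp((8∕φ)·T)` against the LE exit's margin is the instance END's.  Nothing of H3∕(B)∕BetaPertH touched;
`BirthShapeNodup` NOT retired by this file alone; NE7b NOT proved.  HONEST DEPENDENCY (cell): continuum YM on T⁴ ⇐
BetaPertH ∧ nine spine estimates (0/9 proved); BetaPertH ⇐ (D1) ∧ (D4) ∧ CAP+tail; G-an2-4 gates asym, D1 and NE2/3/4.
This file changes none of it.
-/

open Finset
open Literature.MathematicalPhysics.QuantumFieldTheory.Balaban1983to89
open T4PersistenceDictionary T4PrintedShapeBanking T4TaggedShapeBanking T4PartnerMultiplicity T4BranchingRecordsGas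
open Summit.QuantumFields.BalabanUV.T4Continuum.LateMergers
open Summit.QuantumFields.BalabanUV.T4Continuum.HistoryBankingLE
open Summit.QuantumFields.BalabanUV.T4Continuum.HistoryJoins
open Summit.QuantumFields.BalabanUV.T4Continuum.HistorySiblingEntropyBridge
open Summit.QuantumFields.BalabanUV.T4Continuum.HistoryJoinsBudget (mrg)
open Summit.QuantumFields.BalabanUV.T4Continuum.HistoryJoinsEntropyBudget (ENT)
open Summit.QuantumFields.BalabanUV.T4Continuum.HistoryRenewalsCost

namespace Summit.QuantumFields.BalabanUV.T4Continuum.HistoryRenewalsCost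

noncomputable section

open HistoryGen

variable {α π : Type*} [DecidableEq α] [DecidableEq π] (P : HistoryGen.Pedigree α π)

/-- **THE RENEWAL COUNT OF THE FLAT GENEALOGY against the tagged member's booked cost**, in leaf-10 gen 3's letters
(`st := PEv.step`). [folklore] -/
theorem NR_gen_le' (hF : ∀ c, P.Forest c) {C : T4PrintedShapeBanking.Consts} {K : ℕ} {R : ℕ → ℕ}
    (hE₂ : 0 ≤ C.E₂) (hE₃ : 0 ≤ C.E₃) {φ : ℝ} (hφ0 : 0 < φ) (hφ : ∀ n, n ≤ K → φ ≤ floorK C K R n) (c : α)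
    (hc : ConsistentTLE Prod.fst C K R (P.genT c)) :
    (NR PEv.step (P.gen c) : ℝ) ≤ totalCostT Prod.fst C K R (P.genT c) / φ := by
  have hg : P.gen c = relabel Prod.fst (P.genT c) := (HistoryGen.Pedigree.relabel_eq_gmap' Prod.fst (P.genT c)).symm
  rw [hg]
  exact NR_relabel_le_totalCostT_div Prod.fst _ hE₂ hE₃ hφ0 hφ (Pedigree.freshT_genT hF c) hc

/-- **THE BINDER `hENT` ON A CANONICALLY WRITTEN PEDIGREE, RENEWALS PAID BY THE BOOKED COST.**  Conventions
`HeadOldest`, `TailSortedR`, `RenewDated` (leaf-10 gen 3's `ENT_leR_gen`) + `Forest` + the tagged member's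
`ConsistentTLE` + floors `≥ φ > 0` on the run:
`ENT PEv.step (P.gen c) ≤ 2·bsum (1 + PEv.fat) (P.gen c) + 4·partnerAges + 8·mrg + (8 ∕ φ)·totalCostT Prod.fst C K R (P.genT c)`.
[folklore] -/
theorem ENT_le_gen_canon (hH : ∀ c, P.HeadOldest c) (hS : ∀ c, P.TailSortedR c) (hR : P.RenewDated)
    (hF : ∀ c, P.Forest c) {C : T4PrintedShapeBanking.Consts} {K : ℕ} {R : ℕ → ℕ} (hE₂ : 0 ≤ C.E₂) (hE₃ : 0 ≤ C.E₃)
    {φ : ℝ} (hφ0 : 0 < φ) (hφ : ∀ n, n ≤ K → φ ≤ floorK C K R n) (c : α)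
    (hc : ConsistentTLE Prod.fst C K R (P.genT c)) :
    ENT PEv.step (P.gen c) ≤
      2 * bsum (fun b => (1 : ℝ) + PEv.fat b) (P.gen c) + 4 * (partnerAges PEv.step (P.gen c) : ℝ) +
        8 * mrg PEv.step (P.gen c) + 8 / φ * totalCostT Prod.fst C K R (P.genT c) := by
  have h := ENT_leR_gen P hH hS hR c
  have hNR := NR_gen_le' P hF hE₂ hE₃ hφ0 hφ c hc
  have : 8 * (NR PEv.step (P.gen c) : ℝ) ≤ 8 / φ * totalCostT Prod.fst C K R (P.genT c) := by
    rw [div_mul_eq_mul_div, le_div_iff₀ hφ0]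
    have := mul_le_mul_of_nonneg_left hNR (by norm_num : (0 : ℝ) ≤ 8)
    rw [mul_div_assoc'] at this
    exact (le_div_iff₀ hφ0).1 this
  linarith

/-- **READING 1** (`R ≥ 1` on the run, `E₂ > 0`): the renewals cost `(8 ∕ E₂)·totalCostT`. [folklore] -/
theorem ENT_le_gen_canon_E₂ (hH : ∀ c, P.HeadOldest c) (hS : ∀ c, P.TailSortedR c) (hR : P.RenewDated)
    (hF : ∀ c, P.Forest c) {C : T4PrintedShapeBanking.Consts} {K : ℕ} {R : ℕ → ℕ} (hE₂ : 0 < C.E₂) (hE₃ : 0 ≤ C.E₃)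
    (hR1 : ∀ n, n ≤ K → 1 ≤ R n) (c : α) (hc : ConsistentTLE Prod.fst C K R (P.genT c)) :
    ENT PEv.step (P.gen c) ≤
      2 * bsum (fun b => (1 : ℝ) + PEv.fat b) (P.gen c) + 4 * (partnerAges PEv.step (P.gen c) : ℝ) +
        8 * mrg PEv.step (P.gen c) + 8 / C.E₂ * totalCostT Prod.fst C K R (P.genT c) :=
  ENT_le_gen_canon P hH hS hR hF hE₂.le hE₃ hE₂ (fun n hn => E₂_le_floorK (C := C) hE₂.le hn (hR1 n hn)) c hc

/-- **READING 2** (`R ≥ Rm` on the run): the renewals cost `(8 ∕ (E₂·Rm^{q′}))·totalCostT` — the constant the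
instance END uses on a tuned run (`Rm ≫ 1`). [folklore] -/
theorem ENT_le_gen_canon_pow (hH : ∀ c, P.HeadOldest c) (hS : ∀ c, P.TailSortedR c) (hR : P.RenewDated)
    (hF : ∀ c, P.Forest c) {C : T4PrintedShapeBanking.Consts} {K : ℕ} {R : ℕ → ℕ} (hE₂ : 0 < C.E₂) (hE₃ : 0 ≤ C.E₃)
    {Rm : ℕ} (hRm0 : 0 < Rm) (hRm : ∀ n, n ≤ K → Rm ≤ R n) (c : α) (hc : ConsistentTLE Prod.fst C K R (P.genT c)) :
    ENT PEv.step (P.gen c) ≤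
      2 * bsum (fun b => (1 : ℝ) + PEv.fat b) (P.gen c) + 4 * (partnerAges PEv.step (P.gen c) : ℝ) +
        8 * mrg PEv.step (P.gen c) + 8 / (C.E₂ * (Rm : ℝ) ^ C.q') * totalCostT Prod.fst C K R (P.genT c) :=
  ENT_le_gen_canon P hH hS hR hF hE₂.le hE₃ (by positivity)
    (fun n hn => le_floorK_of_le (C := C) hE₂.le hn (hRm n hn)) c hc

end

end Summit.QuantumFields.BalabanUV.T4Continuum.HistoryRenewalsCost
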